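import Literature.NumberTheory.Rogawski1990.ArchHCSmoothBoundedBox     -- ★ p850995 (B1) (LH7-p04 (g4)): `smoothBounded_orbFamGExt_of_forall_wall`, `forall_wall_of_forall_wall_cube`; brings `orbFamGExt`, `InRegG`, `hcThird`
import Literature.NumberTheory.Rogawski1990.ArchTransfFamilyWallGeometry  -- ★ (GLUE-X-dress) FILE B1: `eq_or_eq_or_eq_hcThird` (reused, not restated)
import HarnessLib

/-!
# Clause (I₁) for the extended genuine family from its three wall STRATA: faces (F), cross-place corners (X), compact-scalar corners (C)
# ((I₁-asm) «strata assembler»; Bouaziz 1994 §3.1, Shelstad 1979 §4, Varadarajan 1977 I §1.12)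

Topic `NumberTheory/Rogawski1990`; namespace `Literature.NumberTheory.Rogawski1990`.  THEOREMS ONLY (no definition, no instance, no notation, no axiom,
no named fact, no `sorry`).  Cell `pub/hodgecm-mathlib`, line LH3 (closer stub `stub_N9`, crux H413 = `stmt-HodgeConjecture-24833`), letter L1 clause (I₁)
for ★ `orbFamGExt`; (I₁) spec-owner LH7-p04 (g4) (LH3-plan (g3) RULINGS #15∕#17, CENSUS-I1.v1).  Count-neutral.

THE MATHEMATICS.  A wall point `x ∉ InRegG s S′` carries at least one NONCOMPACT coincidence `e^{i x_{w i}} = e^{i x_{w j}}` (`w ∉ S′` compact place, `s w i ≠ s w j`).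
§1 sorts the wall points into three strata (pure bookkeeping over ★ `mem_inRegG_iff`): **(F)** ONE-WALL — exactly one noncompact coincidence, at one place `w`,
the third eigenvalue off it, no noncompact coincidence at any other compact place (compact coincidences and the split places are free) — the binder shape of
★ `exists_nhds_forall_mem_inRegG_iff_of_oneWall` ∕ `…_of_wallDescent_oneWall` (LH3-p02 (g4)); **(C)** SCALAR CORNER — all three eigenvalues equal at SOME place
carrying a noncompact pair (the `w`-component is central in `U(α)_w`; tested FIRST, so it absorbs every configuration containing a scalar corner — F0P3a-p02 (g21)'s
repair 2026-09-02T10:47:34Z: those are Harish-Chandra-grade whatever happens at the other places); **(X′)** CROSS-PLACE — no scalar corner anywhere (every coincident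
noncompact pair has its third eigenvalue off) and noncompact coincidences at two different places.  §2: in the
fundamental cube (`x w i ∈ [0, 2π)`, ★ (B1)) an eigenvalue coincidence is a LITERAL equality `x w i = x w j`.  §3 HEAD **`smoothBounded_orbFamGExt_of_strata`**:
(I₂) on `InRegG` (the E3 head (A5)) + a local jet bound at every (F)-point (O-L1c-face: ★ `…_of_wallDescent_oneWall` fed by (B-desc′)), near every point with a
scalar corner (O-L1d «HC-CENTRAL», Harish-Chandra's local boundedness at central points of `U(2,1)_w` — PRINT) and at every (X′)-point (O-L1c-X′) give (I₁)+(I₂) for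
★ `orbFamGExt` on every chart, every order, every compact set (through ★ `smoothBounded_orbFamGExt_of_forall_wall`).  Nothing analytic is proved here.
HONEST LABEL: bookkeeping only; HC_CM is proved only modulo the 7 printed citations (2 remaining: hLiu418 = stmt-HodgeConjecture-24832,
h413 = stmt-HodgeConjecture-24833) until rung 0 closes.

## References
* [Bouaziz1994IntegralesOrbitales] A. Bouaziz, *Intégrales orbitales sur les groupes de Lie réductifs*, Ann. Sci. ÉNS 27 (1994), §3.1 p. 579 ((I₁), (I₂)), §3.2 p. 580.
* [Shelstad1979] D. Shelstad, *Characters and inner forms of a quasi-split group over ℝ*, Compositio Math. 39 (1979), §4 pp. 22–25.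
* [Varadarajan1977] V. S. Varadarajan, *Harmonic Analysis on Real Reductive Groups*, LNM 576 (1977), Part I §1.12, §3.
-/

set_option autoImplicit false

noncomputable section

open Set Function Real Filter Topology MeasureTheory NumberField NumberField.InfinitePlace
open Literature.NumberTheory.Automorphic Literature.NumberTheory.Automorphic.ArchCartan Literature.NumberTheory.Automorphic.UnitaryGroup
open scoped ContDiff Classical

namespace Literature.NumberTheory.Rogawski1990

/-! ## §1 The three strata of the wall points -/

section Strata

variable {W : Type*} (s : W → Fin 3 → SignType) (S' : Finset W)

/-- **A wall point carries a noncompact coincidence**: `x ∉ InRegG s S′` iff some compact place `w ∉ S′` and some pair `i ≠ j` with `s w i ≠ s w j` have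
`e^{i x_{w i}} = e^{i x_{w j}}` (unfolding of ★ `InRegG`). [cite: Bouaziz1994IntegralesOrbitales, §6.2 p. 591] -/
theorem not_mem_inRegG_iff (x : W → Fin 3 → ℝ) :
    x ∉ InRegG s S' ↔ ∃ w, w ∉ S' ∧ ∃ i j : Fin 3, i ≠ j ∧ s w i ≠ s w j ∧ Circle.exp (x w i) = Circle.exp (x w j) := by
  rw [mem_inRegG_iff]
  push Not
  rfl

/-- **If one noncompact pair coincides at `w` and the third eigenvalue coincides too, ALL three eigenvalues coincide at `w`** (the scalar corner).
[cite: Shelstad1979, §4 p. 23] -/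
theorem forall_circleExp_eq_of_pair_of_third {x : W → Fin 3 → ℝ} {w : W} {i j : Fin 3} (hij : i ≠ j)
    (h1 : Circle.exp (x w i) = Circle.exp (x w j)) (h2 : Circle.exp (x w (hcThird i j)) = Circle.exp (x w i)) (l l' : Fin 3) :
    Circle.exp (x w l) = Circle.exp (x w l') := by
  have key : ∀ m : Fin 3, Circle.exp (x w m) = Circle.exp (x w i) := by
    intro m
    rcases eq_or_eq_or_eq_hcThird hij m with rfl | rfl | rfl
    · rfl
    · exact h1.symm
    · exact h2
  rw [key l, key l']

/-- **TRICHOTOMY OF THE WALL POINTS** — (F) one-wall (the binder shape of ★ `exists_nhds_forall_mem_inRegG_iff_of_oneWall`), or (C) a scalar corner at some place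
(tested first: it absorbs every configuration containing one), or (X′) cross-place with NO scalar corner (every coincident noncompact pair has its third eigenvalue off,
and two different places carry coincidences). [cite: Bouaziz1994IntegralesOrbitales, §3.1–3.2 pp. 579–580] [cite: Shelstad1979, §4 pp. 22–25] -/
theorem wall_point_trichotomy {x : W → Fin 3 → ℝ} (hx : x ∉ InRegG s S') :
    (∃ (w : W) (i j : Fin 3), w ∉ S' ∧ i ≠ j ∧ s w i ≠ s w j ∧ Circle.exp (x w i) = Circle.exp (x w j) ∧
        Circle.exp (x w (hcThird i j)) ≠ Circle.exp (x w i) ∧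
        ∀ w', w' ∉ S' → w' ≠ w → ∀ i' j' : Fin 3, i' ≠ j' → s w' i' ≠ s w' j' → Circle.exp (x w' i') ≠ Circle.exp (x w' j')) ∨
    (∃ w : W, w ∉ S' ∧ (∃ i j : Fin 3, i ≠ j ∧ s w i ≠ s w j) ∧ ∀ l l' : Fin 3, Circle.exp (x w l) = Circle.exp (x w l')) ∨
    ((∀ w : W, w ∉ S' → ∀ i j : Fin 3, i ≠ j → s w i ≠ s w j → Circle.exp (x w i) = Circle.exp (x w j) →
        Circle.exp (x w (hcThird i j)) ≠ Circle.exp (x w i)) ∧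
      ∃ w₁ w₂ : W, w₁ ≠ w₂ ∧
        (w₁ ∉ S' ∧ ∃ i j : Fin 3, i ≠ j ∧ s w₁ i ≠ s w₁ j ∧ Circle.exp (x w₁ i) = Circle.exp (x w₁ j)) ∧
        (w₂ ∉ S' ∧ ∃ i j : Fin 3, i ≠ j ∧ s w₂ i ≠ s w₂ j ∧ Circle.exp (x w₂ i) = Circle.exp (x w₂ j))) := by
  obtain ⟨w, hw, i, j, hij, hs, heq⟩ := (not_mem_inRegG_iff s S' x).1 hx
  by_cases hC : ∃ w : W, w ∉ S' ∧ (∃ i j : Fin 3, i ≠ j ∧ s w i ≠ s w j) ∧ ∀ l l' : Fin 3, Circle.exp (x w l) = Circle.exp (x w l')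
  · exact Or.inr (Or.inl hC)
  · -- no scalar corner anywhere: every coincident noncompact pair has its third eigenvalue off
    have hthird : ∀ w : W, w ∉ S' → ∀ i j : Fin 3, i ≠ j → s w i ≠ s w j → Circle.exp (x w i) = Circle.exp (x w j) →
        Circle.exp (x w (hcThird i j)) ≠ Circle.exp (x w i) := by
      intro w' hw' i' j' hij' hs' heq' hk
      exact hC ⟨w', hw', ⟨i', j', hij', hs'⟩, forall_circleExp_eq_of_pair_of_third hij' heq' hk⟩
    by_cases hX : ∃ w', w' ∉ S' ∧ w' ≠ w ∧ ∃ i' j' : Fin 3, i' ≠ j' ∧ s w' i' ≠ s w' j' ∧ Circle.exp (x w' i') = Circle.exp (x w' j')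
    · obtain ⟨w', hw', hne, i', j', hij', hs', heq'⟩ := hX
      exact Or.inr (Or.inr ⟨hthird, w, w', hne.symm, ⟨hw, i, j, hij, hs, heq⟩, ⟨hw', i', j', hij', hs', heq'⟩⟩)
    · push Not at hX
      exact Or.inl ⟨w, i, j, hw, hij, hs, heq, hthird w hw i j hij hs heq,
        fun w' hw' hne i' j' hij' hs' => hX w' hw' hne i' j' hij' hs'⟩

/-! ## §2 In the fundamental cube an eigenvalue coincidence is a literal equality -/

/-- `e^{ia} = e^{ib}` with `a, b ∈ [0, 2π)` forces `a = b`. [cite: Shelstad1979, §4 p. 22] -/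
theorem eq_of_circleExp_eq_of_mem_Ico {a b : ℝ} (h : Circle.exp a = Circle.exp b) (ha : a ∈ Ico 0 (2 * π)) (hb : b ∈ Ico 0 (2 * π)) : a = b := by
  by_contra hne
  have hne' : Circle.exp a ≠ Circle.exp b → False := fun h' => h' h
  apply hne'
  rw [circleExp_ne_iff_forall_int]
  intro k hk
  have h1 : -(2 * π) < a - b := by linarith [ha.1, hb.2]
  have h2 : a - b < 2 * π := by linarith [ha.2, hb.1]
  rw [hk] at h1 h2
  have hk1 : (-1 : ℝ) < k := by
    have := lt_of_mul_lt_mul_left (by linarith : 2 * π * (-1 : ℝ) < 2 * π * k) Real.two_pi_pos.le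
    exact this
  have hk2 : (k : ℝ) < 1 := by
    have := lt_of_mul_lt_mul_left (by linarith : 2 * π * (k : ℝ) < 2 * π * 1) Real.two_pi_pos.le
    exact this
  have hk0 : k = 0 := by
    have h3 : (-1 : ℤ) < k := by exact_mod_cast hk1
    have h4 : k < (1 : ℤ) := by exact_mod_cast hk2
    omega
  apply hne
  have : a - b = 0 := by rw [hk, hk0]; simp
  linarith

end Strata

/-! ## §3 HEAD: (I₁)+(I₂) for the extended genuine family from (I₂) and the three strata -/

section Head

variable (L : Type) [Field L] [NumberField L] [IsCMField L] (α : Fin 3 → L)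
  [MeasurableSpace ↥(arch (↥(maximalRealSubfield L)) L (IsCMField.complexConj L) 3 (Matrix.diagonal α))]
  [BorelSpace ↥(arch (↥(maximalRealSubfield L)) L (IsCMField.complexConj L) 3 (Matrix.diagonal α))]
  (ν' : Measure ↥(arch (↥(maximalRealSubfield L)) L (IsCMField.complexConj L) 3 (Matrix.diagonal α))) [ν'.IsHaarMeasure] [ν'.IsMulRightInvariant]

/-- **(I₁-asm) «SMOOTH-BOUNDED» FOR `orbFamGExt` FROM (I₂) AND THE THREE WALL STRATA.**  `h1` = clause (I₂) on every chart (the E3 head (A5)); `hF` = a local bound of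
every jet at every ONE-WALL point of the fundamental cube, in the binder shape of ★ `exists_nhds_bddAbove_norm_iteratedFDeriv_orbFamGExt_of_wallDescent_oneWall`
(LH3-p02 (g4); literal `x w i = x w j`, third eigenvalue off, no other noncompact coincidence) — organ O-L1c-face, in-house via (B-desc′); `hC` = the same near every
point with a SCALAR CORNER at some place — organ O-L1d «HC-CENTRAL», Harish-Chandra's local boundedness of the normalised invariant integral at central points of
`U(2,1)_w`, PRINT (whatever the other places do); `hX` = the same at every CROSS-PLACE corner WITHOUT scalar corner (every coincident noncompact pair one-wall) —
organ O-L1c-X′ (two-block box descent + nested `ℓ^∞`-family bounds; in-house road (X1)–(X3) of F0P3a-p02 (g21), or folded into print by the planner).  All three callbacks also receive the CUBE fact `∀ w ∉ S′, ∀ l, x w l ∈ [0, 2π)` (so every coincidence they meet is a literal equality, §2).  Conclusion: the `h1` of ★ `archHcSmoothOneSided_of_smoothBounded_of_jump`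
for ★ `orbFamGExt L α ν′ a′` — (I₁)+(I₂) on `InRegG (slotSign L α) S′` for every chart, order and compact set.
[cite: Bouaziz1994IntegralesOrbitales, §3.1 (I₁)–(I₂) p. 579; §3.2 p. 580] [cite: Shelstad1979, §4 pp. 22–25] [cite: Varadarajan1977, I §1.12, §3] -/
theorem smoothBounded_orbFamGExt_of_strata (a' : ↥(arch (↥(maximalRealSubfield L)) L (IsCMField.complexConj L) 3 (Matrix.diagonal α)) → ℂ)
    (h1 : ∀ S' : Finset {w : InfinitePlace L // IsComplex w}, ContDiffOn ℝ ∞ (orbFamGExt L α ν' a' S') (InRegG (slotSign L α) S'))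
    (hF : ∀ (S' : Finset {w : InfinitePlace L // IsComplex w}) (n : ℕ) (x : {w : InfinitePlace L // IsComplex w} → Fin 3 → ℝ)
      (w : {w : InfinitePlace L // IsComplex w}) (i j : Fin 3),
      (∀ w' : {w : InfinitePlace L // IsComplex w}, w' ∉ S' → ∀ l : Fin 3, x w' l ∈ Ico 0 (2 * π)) →
      w ∉ S' → i ≠ j → slotSign L α w i ≠ slotSign L α w j → x w i = x w j →
        Circle.exp (x w (hcThird i j)) ≠ Circle.exp (x w i) →
        (∀ w', w' ∉ S' → w' ≠ w → ∀ i' j' : Fin 3, i' ≠ j' → slotSign L α w' i' ≠ slotSign L α w' j' → Circle.exp (x w' i') ≠ Circle.exp (x w' j')) →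
        ∃ U ∈ 𝓝 x, BddAbove ((fun c => ‖iteratedFDeriv ℝ n (orbFamGExt L α ν' a' S') c‖) '' (U ∩ InRegG (slotSign L α) S')))
    (hC : ∀ (S' : Finset {w : InfinitePlace L // IsComplex w}) (n : ℕ) (x : {w : InfinitePlace L // IsComplex w} → Fin 3 → ℝ),
      (∀ w' : {w : InfinitePlace L // IsComplex w}, w' ∉ S' → ∀ l : Fin 3, x w' l ∈ Ico 0 (2 * π)) →
      (∃ w : {w : InfinitePlace L // IsComplex w}, w ∉ S' ∧ (∃ i j : Fin 3, i ≠ j ∧ slotSign L α w i ≠ slotSign L α w j) ∧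
        ∀ l l' : Fin 3, Circle.exp (x w l) = Circle.exp (x w l')) →
        ∃ U ∈ 𝓝 x, BddAbove ((fun c => ‖iteratedFDeriv ℝ n (orbFamGExt L α ν' a' S') c‖) '' (U ∩ InRegG (slotSign L α) S')))
    (hX : ∀ (S' : Finset {w : InfinitePlace L // IsComplex w}) (n : ℕ) (x : {w : InfinitePlace L // IsComplex w} → Fin 3 → ℝ),
      (∀ w' : {w : InfinitePlace L // IsComplex w}, w' ∉ S' → ∀ l : Fin 3, x w' l ∈ Ico 0 (2 * π)) →
      (∀ w : {w : InfinitePlace L // IsComplex w}, w ∉ S' → ∀ i j : Fin 3, i ≠ j → slotSign L α w i ≠ slotSign L α w j →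
        Circle.exp (x w i) = Circle.exp (x w j) → Circle.exp (x w (hcThird i j)) ≠ Circle.exp (x w i)) →
      (∃ w₁ w₂ : {w : InfinitePlace L // IsComplex w}, w₁ ≠ w₂ ∧
        (w₁ ∉ S' ∧ ∃ i j : Fin 3, i ≠ j ∧ slotSign L α w₁ i ≠ slotSign L α w₁ j ∧ Circle.exp (x w₁ i) = Circle.exp (x w₁ j)) ∧
        (w₂ ∉ S' ∧ ∃ i j : Fin 3, i ≠ j ∧ slotSign L α w₂ i ≠ slotSign L α w₂ j ∧ Circle.exp (x w₂ i) = Circle.exp (x w₂ j))) →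
        ∃ U ∈ 𝓝 x, BddAbove ((fun c => ‖iteratedFDeriv ℝ n (orbFamGExt L α ν' a' S') c‖) '' (U ∩ InRegG (slotSign L α) S'))) :
    ∀ S' : Finset {w : InfinitePlace L // IsComplex w}, ContDiffOn ℝ ∞ (orbFamGExt L α ν' a' S') (InRegG (slotSign L α) S') ∧
      ∀ (n : ℕ) (K : Set ({w : InfinitePlace L // IsComplex w} → Fin 3 → ℝ)), IsCompact K →
        BddAbove ((fun c => ‖iteratedFDeriv ℝ n (orbFamGExt L α ν' a' S') c‖) '' (K ∩ InRegG (slotSign L α) S')) := by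
  refine smoothBounded_orbFamGExt_of_forall_wall L α ν' a' h1 fun S' n x hx hcube => ?_
  rcases wall_point_trichotomy (slotSign L α) S' hx with hFx | hCx | hXx
  · obtain ⟨w, i, j, hw, hij, hs, heq, hk, hin⟩ := hFx
    exact hF S' n x w i j hcube hw hij hs (eq_of_circleExp_eq_of_mem_Ico heq (hcube w hw i) (hcube w hw j)) hk hin
  · exact hC S' n x hcube hCx
  · exact hX S' n x hcube hXx.1 hXx.2

end Head

/-! ## §4 (ED. 2, append-only) The scalar corner split: (C₀) «scalar at ONE place, in-regular at every other compact place» ∕ (C_mixed) -/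

section Strata4

variable {W : Type*} (s : W → Fin 3 → SignType) (S' : Finset W)

/-- **TETRACHOTOMY OF THE WALL POINTS** (ED. 2; LH3-plan (g4) RULING #18, F0P3a-p05 (g20) (B3-JUNCTION)): (F) one-wall, or **(C₀)** scalar corner at ONE compact place `w`
with NO noncompact coincidence at any other compact place (compact coincidences and the split places free) — the in-house road (B3) (F0P3a-p09's engine at `w`, the other
places as smooth parameters), or **(C_mixed)** scalar corner at `w` AND a noncompact coincidence (face, corner or scalar) at another compact place `w′` — the nested
`ℓ^∞`-family induction shared with (X3), or (X′) cross-place without scalar corner. [cite: Bouaziz1994IntegralesOrbitales, §3.1–3.2 pp. 579–580]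
[cite: Shelstad1979, §4 pp. 22–25] [cite: Varadarajan1977, I §1.12, §3] -/
theorem wall_point_tetrachotomy {x : W → Fin 3 → ℝ} (hx : x ∉ InRegG s S') :
    (∃ (w : W) (i j : Fin 3), w ∉ S' ∧ i ≠ j ∧ s w i ≠ s w j ∧ Circle.exp (x w i) = Circle.exp (x w j) ∧
        Circle.exp (x w (hcThird i j)) ≠ Circle.exp (x w i) ∧
        ∀ w', w' ∉ S' → w' ≠ w → ∀ i' j' : Fin 3, i' ≠ j' → s w' i' ≠ s w' j' → Circle.exp (x w' i') ≠ Circle.exp (x w' j')) ∨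
    (∃ w : W, w ∉ S' ∧ (∃ i j : Fin 3, i ≠ j ∧ s w i ≠ s w j) ∧ (∀ l l' : Fin 3, Circle.exp (x w l) = Circle.exp (x w l')) ∧
        ∀ w', w' ∉ S' → w' ≠ w → ∀ i' j' : Fin 3, i' ≠ j' → s w' i' ≠ s w' j' → Circle.exp (x w' i') ≠ Circle.exp (x w' j')) ∨
    (∃ w : W, w ∉ S' ∧ (∃ i j : Fin 3, i ≠ j ∧ s w i ≠ s w j) ∧ (∀ l l' : Fin 3, Circle.exp (x w l) = Circle.exp (x w l')) ∧
        ∃ w', w' ∉ S' ∧ w' ≠ w ∧ ∃ i' j' : Fin 3, i' ≠ j' ∧ s w' i' ≠ s w' j' ∧ Circle.exp (x w' i') = Circle.exp (x w' j')) ∨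
    ((∀ w : W, w ∉ S' → ∀ i j : Fin 3, i ≠ j → s w i ≠ s w j → Circle.exp (x w i) = Circle.exp (x w j) →
        Circle.exp (x w (hcThird i j)) ≠ Circle.exp (x w i)) ∧
      ∃ w₁ w₂ : W, w₁ ≠ w₂ ∧
        (w₁ ∉ S' ∧ ∃ i j : Fin 3, i ≠ j ∧ s w₁ i ≠ s w₁ j ∧ Circle.exp (x w₁ i) = Circle.exp (x w₁ j)) ∧
        (w₂ ∉ S' ∧ ∃ i j : Fin 3, i ≠ j ∧ s w₂ i ≠ s w₂ j ∧ Circle.exp (x w₂ i) = Circle.exp (x w₂ j))) := by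
  rcases wall_point_trichotomy s S' hx with hF | hC | hX
  · exact Or.inl hF
  · obtain ⟨w, hw, hnc, hsc⟩ := hC
    by_cases hm : ∃ w', w' ∉ S' ∧ w' ≠ w ∧ ∃ i' j' : Fin 3, i' ≠ j' ∧ s w' i' ≠ s w' j' ∧ Circle.exp (x w' i') = Circle.exp (x w' j')
    · exact Or.inr (Or.inr (Or.inl ⟨w, hw, hnc, hsc, hm⟩))
    · push Not at hm
      exact Or.inr (Or.inl ⟨w, hw, hnc, hsc, fun w' hw' hne i' j' hij' hs' => hm w' hw' hne i' j' hij' hs'⟩)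
  · exact Or.inr (Or.inr (Or.inr hX))

end Strata4

section Head4

variable (L : Type) [Field L] [NumberField L] [IsCMField L] (α : Fin 3 → L)
  [MeasurableSpace ↥(arch (↥(maximalRealSubfield L)) L (IsCMField.complexConj L) 3 (Matrix.diagonal α))]
  [BorelSpace ↥(arch (↥(maximalRealSubfield L)) L (IsCMField.complexConj L) 3 (Matrix.diagonal α))]
  (ν' : Measure ↥(arch (↥(maximalRealSubfield L)) L (IsCMField.complexConj L) 3 (Matrix.diagonal α))) [ν'.IsHaarMeasure] [ν'.IsMulRightInvariant]

/-- **(I₁-asm) ED. 2 — «SMOOTH-BOUNDED» FOR `orbFamGExt` FROM (I₂) AND FOUR WALL STRATA** (the scalar corner split of LH3-plan (g4) RULING #18): `h1` = (I₂) (★ (A5)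
`contDiffOn_orbFamGExt_inRegG`); `hF` = O-L1c-face (one-wall points); `hC₀` = O-L1d₀ «scalar at ONE place, in-regular at the other compact places» — F0P3a-p05 (g20)'s
(B3-JUNCTION) head `exists_nhds_bddAbove_norm_iteratedFDeriv_orbFamGExt_of_scalarCorner` over F0P3a-p09 (g7)'s (B3-ENGINE), binders VERBATIM (cube, `w`, `hw`, nc-pair
witness, `hsc`, `hreg′`); `hCm` = O-L1d-mixed «scalar at `w` + a noncompact coincidence at another compact place» (nested `ℓ^∞`-family induction, shared with (X3));
`hX` = O-L1e X′-corners.  All callbacks receive the cube fact first.  Conclusion = the `h1` of ★ `archHcSmoothOneSided_of_smoothBounded_of_jump` for ★ `orbFamGExt L α ν′ a′`.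
[cite: Bouaziz1994IntegralesOrbitales, §3.1 (I₁)–(I₂) p. 579; §3.2 p. 580] [cite: Shelstad1979, §4 pp. 22–25] [cite: Varadarajan1977, I §1.12, §3] -/
theorem smoothBounded_orbFamGExt_of_strata₄ (a' : ↥(arch (↥(maximalRealSubfield L)) L (IsCMField.complexConj L) 3 (Matrix.diagonal α)) → ℂ)
    (h1 : ∀ S' : Finset {w : InfinitePlace L // IsComplex w}, ContDiffOn ℝ ∞ (orbFamGExt L α ν' a' S') (InRegG (slotSign L α) S'))
    (hF : ∀ (S' : Finset {w : InfinitePlace L // IsComplex w}) (n : ℕ) (x : {w : InfinitePlace L // IsComplex w} → Fin 3 → ℝ)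
      (w : {w : InfinitePlace L // IsComplex w}) (i j : Fin 3),
      (∀ w' : {w : InfinitePlace L // IsComplex w}, w' ∉ S' → ∀ l : Fin 3, x w' l ∈ Ico 0 (2 * π)) →
      w ∉ S' → i ≠ j → slotSign L α w i ≠ slotSign L α w j → x w i = x w j →
        Circle.exp (x w (hcThird i j)) ≠ Circle.exp (x w i) →
        (∀ w', w' ∉ S' → w' ≠ w → ∀ i' j' : Fin 3, i' ≠ j' → slotSign L α w' i' ≠ slotSign L α w' j' → Circle.exp (x w' i') ≠ Circle.exp (x w' j')) →
        ∃ U ∈ 𝓝 x, BddAbove ((fun c => ‖iteratedFDeriv ℝ n (orbFamGExt L α ν' a' S') c‖) '' (U ∩ InRegG (slotSign L α) S')))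
    (hC₀ : ∀ (S' : Finset {w : InfinitePlace L // IsComplex w}) (n : ℕ) (x : {w : InfinitePlace L // IsComplex w} → Fin 3 → ℝ),
      (∀ w' : {w : InfinitePlace L // IsComplex w}, w' ∉ S' → ∀ l : Fin 3, x w' l ∈ Ico 0 (2 * π)) →
      (∃ w : {w : InfinitePlace L // IsComplex w}, w ∉ S' ∧ (∃ i j : Fin 3, i ≠ j ∧ slotSign L α w i ≠ slotSign L α w j) ∧
        (∀ l l' : Fin 3, Circle.exp (x w l) = Circle.exp (x w l')) ∧
        ∀ w', w' ∉ S' → w' ≠ w → ∀ i' j' : Fin 3, i' ≠ j' → slotSign L α w' i' ≠ slotSign L α w' j' → Circle.exp (x w' i') ≠ Circle.exp (x w' j')) →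
        ∃ U ∈ 𝓝 x, BddAbove ((fun c => ‖iteratedFDeriv ℝ n (orbFamGExt L α ν' a' S') c‖) '' (U ∩ InRegG (slotSign L α) S')))
    (hCm : ∀ (S' : Finset {w : InfinitePlace L // IsComplex w}) (n : ℕ) (x : {w : InfinitePlace L // IsComplex w} → Fin 3 → ℝ),
      (∀ w' : {w : InfinitePlace L // IsComplex w}, w' ∉ S' → ∀ l : Fin 3, x w' l ∈ Ico 0 (2 * π)) →
      (∃ w : {w : InfinitePlace L // IsComplex w}, w ∉ S' ∧ (∃ i j : Fin 3, i ≠ j ∧ slotSign L α w i ≠ slotSign L α w j) ∧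
        (∀ l l' : Fin 3, Circle.exp (x w l) = Circle.exp (x w l')) ∧
        ∃ w', w' ∉ S' ∧ w' ≠ w ∧ ∃ i' j' : Fin 3, i' ≠ j' ∧ slotSign L α w' i' ≠ slotSign L α w' j' ∧ Circle.exp (x w' i') = Circle.exp (x w' j')) →
        ∃ U ∈ 𝓝 x, BddAbove ((fun c => ‖iteratedFDeriv ℝ n (orbFamGExt L α ν' a' S') c‖) '' (U ∩ InRegG (slotSign L α) S')))
    (hX : ∀ (S' : Finset {w : InfinitePlace L // IsComplex w}) (n : ℕ) (x : {w : InfinitePlace L // IsComplex w} → Fin 3 → ℝ),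
      (∀ w' : {w : InfinitePlace L // IsComplex w}, w' ∉ S' → ∀ l : Fin 3, x w' l ∈ Ico 0 (2 * π)) →
      (∀ w : {w : InfinitePlace L // IsComplex w}, w ∉ S' → ∀ i j : Fin 3, i ≠ j → slotSign L α w i ≠ slotSign L α w j →
        Circle.exp (x w i) = Circle.exp (x w j) → Circle.exp (x w (hcThird i j)) ≠ Circle.exp (x w i)) →
      (∃ w₁ w₂ : {w : InfinitePlace L // IsComplex w}, w₁ ≠ w₂ ∧
        (w₁ ∉ S' ∧ ∃ i j : Fin 3, i ≠ j ∧ slotSign L α w₁ i ≠ slotSign L α w₁ j ∧ Circle.exp (x w₁ i) = Circle.exp (x w₁ j)) ∧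
        (w₂ ∉ S' ∧ ∃ i j : Fin 3, i ≠ j ∧ slotSign L α w₂ i ≠ slotSign L α w₂ j ∧ Circle.exp (x w₂ i) = Circle.exp (x w₂ j))) →
        ∃ U ∈ 𝓝 x, BddAbove ((fun c => ‖iteratedFDeriv ℝ n (orbFamGExt L α ν' a' S') c‖) '' (U ∩ InRegG (slotSign L α) S'))) :
    ∀ S' : Finset {w : InfinitePlace L // IsComplex w}, ContDiffOn ℝ ∞ (orbFamGExt L α ν' a' S') (InRegG (slotSign L α) S') ∧
      ∀ (n : ℕ) (K : Set ({w : InfinitePlace L // IsComplex w} → Fin 3 → ℝ)), IsCompact K →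
        BddAbove ((fun c => ‖iteratedFDeriv ℝ n (orbFamGExt L α ν' a' S') c‖) '' (K ∩ InRegG (slotSign L α) S')) :=
  smoothBounded_orbFamGExt_of_strata L α ν' a' h1 hF
    (fun S' n x hcube hC => by
      obtain ⟨w, hw, hnc, hsc⟩ := hC
      by_cases hm : ∃ w', w' ∉ S' ∧ w' ≠ w ∧ ∃ i' j' : Fin 3, i' ≠ j' ∧ slotSign L α w' i' ≠ slotSign L α w' j' ∧
          Circle.exp (x w' i') = Circle.exp (x w' j')
      · exact hCm S' n x hcube ⟨w, hw, hnc, hsc, hm⟩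
      · push Not at hm
        exact hC₀ S' n x hcube ⟨w, hw, hnc, hsc, fun w' hw' hne i' j' hij' hs' => hm w' hw' hne i' j' hij' hs'⟩)
    hX

end Head4

end Literature.NumberTheory.Rogawski1990

end
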